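import Summits.ABC.ABC.Theses.FeketeScales

/-!
# abc triples supported on two primes `{2, p}`, `p ≤ 13` (helper for the negative lane of crux stmt-ABC-2160)

Helper file on the NEGATIVE lane of the crux `Summit.ABC.ABC.Theses.FeketeScales.ScaleSubmultiplicativity`
(route `FeketeScales`, ABC/ABC; disprover refuter-cdisprove-stmt-ABC-2160-0), used by
`Negative/SmallScales.lean` (every abc triple of radical `≤ 29` has `c ≤ 9`).  Contents:

* congruence lemmas: `1 + p^t = 2^i` with `p ∈ {3,5,7,11,13}` forces `2^i ≤ 8` (mod `16`);
  `1 + 2^i = 3^u ⟹ 3^u ≤ 9` (mod `16`, then mod `5`); `1 + 2^i = 5^u ⟹ 5^u ≤ 5` (mod `8`, then mod `3`);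
  `1 + 2^i = p^u` impossible for `p ∈ {7, 11, 13}` (mod `3` / mod `5`) — for `{2,3}` this is Levi ben Gerson's
  theorem (1343) that `1+2=3, 1+3=4, 1+8=9` are the only neighbouring `{2,3}`-numbers beyond `1+1=2`;
* the SHAPE LEMMA `ScaleSubmultiplicativity.shape_of_primeFactors_subset`: if every prime factor of `abc`
  lies in `{2, p}` (`p` an odd prime) then, by pairwise coprimality, `c = 2^i` with `1 + p^t = 2^i` or
  `c = p^u` with `1 + 2^i = p^u`;
* `ScaleSubmultiplicativity.le_nine_of_shape`: in either shape `c ≤ 9` for `p ∈ {3,5,7,11,13}`.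

Elementary; Mathlib only (`Nat.eq_prime_pow_of_unique_prime_dvd`, `Nat.pow_mod`).
-/

-- `Summit.<Summit>.<Problem>` is the mandated summit-side namespace (CONVENTIONS §2); for the
-- single-conjunct summit `ABC` the two coincide, so the duplicate `ABC.ABC` is deliberate.
set_option linter.dupNamespace false

namespace Summit.ABC.ABC.Theorems

open Literature.NumberTheory.DiophantineGeometry

/-! ### Exponential congruences -/

/-- Periodicity of powers modulo `m`: if `a^k ≡ 1 (mod m)` then `a^n ≡ a^{n mod k} (mod m)`. [folklore] -/
theorem ScaleSubmultiplicativity.pow_mod_of_pow_mod_eq_one {a k m : ℕ} (h : a ^ k % m = 1) (n : ℕ) :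
    a ^ n % m = a ^ (n % k) % m := by
  have h1 : 1 % m = 1 := by
    calc 1 % m = a ^ k % m % m := by rw [h]
      _ = a ^ k % m := Nat.mod_mod _ _
      _ = 1 := h
  have h2 : (a ^ k) ^ (n / k) % m = 1 := by
    rw [Nat.pow_mod, h, one_pow, h1]
  calc a ^ n % m = (a ^ (n % k) * (a ^ k) ^ (n / k)) % m := by
        rw [← pow_mul, ← pow_add, Nat.mod_add_div]
    _ = ((a ^ (n % k) % m) * ((a ^ k) ^ (n / k) % m)) % m := Nat.mul_mod _ _ _
    _ = a ^ (n % k) % m := by rw [h2, mul_one, Nat.mod_mod]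

/-- `1 + p^t = 2^i` with `p ∈ {3,5,7,11,13}` forces `2^i ≤ 8` (congruences mod `16`: `p^4 ≡ 1`, and
`1 + p^r ≢ 0 (mod 16)` for `r < 4`). [folklore] -/
theorem ScaleSubmultiplicativity.two_pow_le_of_one_add_pow {p t i : ℕ}
    (hp : p = 3 ∨ p = 5 ∨ p = 7 ∨ p = 11 ∨ p = 13) (h : 1 + p ^ t = 2 ^ i) : 2 ^ i ≤ 8 := by
  by_contra hlt
  push Not at hlt
  have hi : 4 ≤ i := by
    by_contra hi
    push Not at hi
    have : 2 ^ i ≤ 2 ^ 3 := Nat.pow_le_pow_right (by norm_num) (by omega)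
    omega
  have h16 : 2 ^ i % 16 = 0 := by
    obtain ⟨j, rfl⟩ := Nat.exists_eq_add_of_le hi
    rw [pow_add]; norm_num [Nat.mul_mod_right]
  have hp4 : p ^ 4 % 16 = 1 := by
    rcases hp with rfl | rfl | rfl | rfl | rfl <;> norm_num
  have hper := ScaleSubmultiplicativity.pow_mod_of_pow_mod_eq_one hp4 t
  have hr : t % 4 < 4 := Nat.mod_lt _ (by norm_num)
  have hsum : (1 + p ^ (t % 4)) % 16 = 0 := by
    have : (1 + p ^ t) % 16 = 0 := by rw [h]; exact h16
    rw [Nat.add_mod, hper, ← Nat.add_mod]  at this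
    exact this
  generalize t % 4 = r at hr hsum
  interval_cases r <;> rcases hp with rfl | rfl | rfl | rfl | rfl <;> norm_num at hsum

/-- `1 + 2^i = 3^u` forces `3^u ≤ 9` (if `i ≥ 4` then `3^u ≡ 1 (mod 16)`, so `4 ∣ u`, so `5 ∣ 3^u - 1 = 2^i`).
[folklore] -/
theorem ScaleSubmultiplicativity.three_pow_le_of_one_add_two_pow {i u : ℕ} (h : 1 + 2 ^ i = 3 ^ u) :
    3 ^ u ≤ 9 := by
  by_contra hlt
  push Not at hlt
  have hi : 4 ≤ i := by
    by_contra hi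
    push Not at hi
    have : 2 ^ i ≤ 2 ^ 3 := Nat.pow_le_pow_right (by norm_num) (by omega)
    omega
  have h16 : 2 ^ i % 16 = 0 := by
    obtain ⟨j, rfl⟩ := Nat.exists_eq_add_of_le hi
    rw [pow_add]; norm_num [Nat.mul_mod_right]
  have h3u : 3 ^ u % 16 = 1 := by omega
  have hper := ScaleSubmultiplicativity.pow_mod_of_pow_mod_eq_one (show 3 ^ 4 % 16 = 1 by norm_num) u
  rw [h3u] at hper
  have hu4 : u % 4 = 0 := by
    have hr : u % 4 < 4 := Nat.mod_lt _ (by norm_num)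
    generalize u % 4 = r at hr hper
    interval_cases r <;> revert hper <;> decide
  obtain ⟨q, hq⟩ : ∃ q, u = 4 * q := ⟨u / 4, by omega⟩
  have h5 : 3 ^ u % 5 = 1 := by
    rw [hq, pow_mul, Nat.pow_mod]; norm_num
  have h25 : 2 ^ i % 5 = 0 := by omega
  have h52 : (5 : ℕ) ∣ 2 := Nat.prime_five.dvd_of_dvd_pow (Nat.dvd_of_mod_eq_zero h25)
  omega

/-- `1 + 2^i = 5^u` forces `5^u ≤ 5` (if `i ≥ 3` then `5^u ≡ 1 (mod 8)`, so `u` is even, so `3 ∣ 5^u - 1 = 2^i`).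
[folklore] -/
theorem ScaleSubmultiplicativity.five_pow_le_of_one_add_two_pow {i u : ℕ} (h : 1 + 2 ^ i = 5 ^ u) :
    5 ^ u ≤ 5 := by
  by_contra hlt
  push Not at hlt
  have hi : 3 ≤ i := by
    by_contra hi
    push Not at hi
    have : 2 ^ i ≤ 2 ^ 2 := Nat.pow_le_pow_right (by norm_num) (by omega)
    omega
  have h8 : 2 ^ i % 8 = 0 := by
    obtain ⟨j, rfl⟩ := Nat.exists_eq_add_of_le hi
    rw [pow_add]; norm_num [Nat.mul_mod_right]
  have h5u : 5 ^ u % 8 = 1 := by omega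
  have hper := ScaleSubmultiplicativity.pow_mod_of_pow_mod_eq_one (show 5 ^ 2 % 8 = 1 by norm_num) u
  rw [h5u] at hper
  have hu2 : u % 2 = 0 := by
    have hr : u % 2 < 2 := Nat.mod_lt _ (by norm_num)
    generalize u % 2 = r at hr hper
    interval_cases r <;> revert hper <;> decide
  obtain ⟨q, hq⟩ : ∃ q, u = 2 * q := ⟨u / 2, by omega⟩
  have h3 : 5 ^ u % 3 = 1 := by
    rw [hq, pow_mul, Nat.pow_mod]; norm_num
  have h23 : 2 ^ i % 3 = 0 := by omega
  have h32 : (3 : ℕ) ∣ 2 := Nat.prime_three.dvd_of_dvd_pow (Nat.dvd_of_mod_eq_zero h23)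
  omega

/-- `1 + 2^i = p^u` is impossible for `p ∈ {7, 11, 13}` (`p ≡ 1` mod `3` or mod `5`). [folklore] -/
theorem ScaleSubmultiplicativity.not_one_add_two_pow_eq_pow {p i u : ℕ} (hp : p = 7 ∨ p = 11 ∨ p = 13)
    (h : 1 + 2 ^ i = p ^ u) : False := by
  rcases hp with rfl | rfl | rfl
  · have h7 : 7 ^ u % 3 = 1 := by rw [Nat.pow_mod]; norm_num
    have h23 : 2 ^ i % 3 = 0 := by omega
    have h32 : (3 : ℕ) ∣ 2 := Nat.prime_three.dvd_of_dvd_pow (Nat.dvd_of_mod_eq_zero h23)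
    omega
  · have h11 : 11 ^ u % 5 = 1 := by rw [Nat.pow_mod]; norm_num
    have h25 : 2 ^ i % 5 = 0 := by omega
    have h52 : (5 : ℕ) ∣ 2 := Nat.prime_five.dvd_of_dvd_pow (Nat.dvd_of_mod_eq_zero h25)
    omega
  · have h13 : 13 ^ u % 3 = 1 := by rw [Nat.pow_mod]; norm_num
    have h23 : 2 ^ i % 3 = 0 := by omega
    have h32 : (3 : ℕ) ∣ 2 := Nat.prime_three.dvd_of_dvd_pow (Nat.dvd_of_mod_eq_zero h23)
    omega

/-- The two exponential shapes at the primes `p ∈ {3,5,7,11,13}` have `c ≤ 9`. [folklore] -/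
theorem ScaleSubmultiplicativity.le_nine_of_shape {p c : ℕ} (hp : p = 3 ∨ p = 5 ∨ p = 7 ∨ p = 11 ∨ p = 13)
    (h : (∃ i t, c = 2 ^ i ∧ 1 + p ^ t = 2 ^ i) ∨ (∃ i u, c = p ^ u ∧ 1 + 2 ^ i = p ^ u)) : c ≤ 9 := by
  rcases h with ⟨i, t, rfl, h⟩ | ⟨i, u, rfl, h⟩
  · exact (ScaleSubmultiplicativity.two_pow_le_of_one_add_pow hp h).trans (by norm_num)
  · rcases hp with rfl | rfl | hp'
    · exact ScaleSubmultiplicativity.three_pow_le_of_one_add_two_pow h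
    · exact (ScaleSubmultiplicativity.five_pow_le_of_one_add_two_pow h).trans (by norm_num)
    · exact (ScaleSubmultiplicativity.not_one_add_two_pow_eq_pow hp' h).elim

/-! ### The shape of an abc triple supported on `{2, p}` -/

/-- A positive integer all of whose prime factors equal `p` is a power of `p`. [folklore] -/
theorem ScaleSubmultiplicativity.exists_eq_pow_of_prime_dvd {m p : ℕ} (hm : m ≠ 0)
    (h : ∀ q, q.Prime → q ∣ m → q = p) : ∃ k, m = p ^ k :=
  ⟨_, Nat.eq_prime_pow_of_unique_prime_dvd hm (fun hd hdm => h _ hd hdm)⟩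

/-- **Shape lemma.**  If every prime factor of `abc` lies in `{2, p}` (`p` an odd prime), then pairwise
coprimality forces `(a, b, c)` to be `(1, p^t, 2^i)`, `(p^t, 1, 2^i)`, `(1, 2^i, p^u)` or `(2^i, 1, p^u)`:
so `c = 2^i` with `1 + p^t = 2^i`, or `c = p^u` with `1 + 2^i = p^u`. [folklore] -/
theorem ScaleSubmultiplicativity.shape_of_primeFactors_subset {a b c p : ℕ} (h : IsABCTriple a b c)
    (hpp : p.Prime) (hp2 : p ≠ 2) (hprimes : ∀ q, q.Prime → q ∣ a * b * c → q = 2 ∨ q = p) :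
    (∃ i t, c = 2 ^ i ∧ 1 + p ^ t = 2 ^ i) ∨ (∃ i u, c = p ^ u ∧ 1 + 2 ^ i = p ^ u) := by
  obtain ⟨ha, hb, habc, hcop⟩ := h
  have ha0 : a ≠ 0 := ha.ne'
  have hb0 : b ≠ 0 := hb.ne'
  have hc0 : c ≠ 0 := by omega
  have hac : Nat.Coprime a c := by rw [← habc]; exact Nat.coprime_self_add_right.mpr hcop
  have hbc : Nat.Coprime b c := by rw [← habc]; exact Nat.coprime_add_self_right.mpr hcop.symm
  -- prime factors of `a`, `b`, `c` lie in `{2, p}`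
  have hpa : ∀ q, q.Prime → q ∣ a → q = 2 ∨ q = p :=
    fun q hq hqa => hprimes q hq (hqa.trans ⟨b * c, by ring⟩)
  have hpb : ∀ q, q.Prime → q ∣ b → q = 2 ∨ q = p :=
    fun q hq hqb => hprimes q hq (hqb.trans ⟨a * c, by ring⟩)
  have hpc : ∀ q, q.Prime → q ∣ c → q = 2 ∨ q = p :=
    fun q hq hqc => hprimes q hq (hqc.trans ⟨a * b, by ring⟩)
  -- a common prime divisor contradicts coprimality
  have key : ∀ {x y q : ℕ}, Nat.Coprime x y → q.Prime → q ∣ x → q ∣ y → False := by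
    intro x y q hxy hq hqx hqy
    have := Nat.dvd_gcd hqx hqy
    rw [hxy] at this
    exact hq.one_lt.ne' (Nat.dvd_one.mp this)
  rcases Nat.even_or_odd c with hce | hco
  · -- `c` even: `a`, `b` odd, hence powers of `p`, one of them `1`; and `c` is a power of `2`
    have h2c : 2 ∣ c := hce.two_dvd
    have h2a : ¬ 2 ∣ a := fun h2a => key hac Nat.prime_two h2a h2c
    have h2b : ¬ 2 ∣ b := fun h2b => key hbc Nat.prime_two h2b h2c
    obtain ⟨s, hs⟩ := ScaleSubmultiplicativity.exists_eq_pow_of_prime_dvd ha0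
      (fun q hq hqa => (hpa q hq hqa).resolve_left (fun h => h2a (by rw [← h]; exact hqa)))
    obtain ⟨t, ht⟩ := ScaleSubmultiplicativity.exists_eq_pow_of_prime_dvd hb0
      (fun q hq hqb => (hpb q hq hqb).resolve_left (fun h => h2b (by rw [← h]; exact hqb)))
    -- `c` is a power of `2`: `p ∣ c` is impossible
    have hpc' : ¬ p ∣ c := by
      intro hpc_dvd
      -- then `p ∤ a` and `p ∤ b`, so `s = t = 0`, `c = 2`, `p ∣ 2`
      have hpa' : ¬ p ∣ a := fun h => key hac hpp h hpc_dvd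
      have hpb' : ¬ p ∣ b := fun h => key hbc hpp h hpc_dvd
      have hs0 : s = 0 := by
        by_contra hs0
        exact hpa' (by rw [hs]; exact dvd_pow_self p hs0)
      have ht0 : t = 0 := by
        by_contra ht0
        exact hpb' (by rw [ht]; exact dvd_pow_self p ht0)
      rw [hs0, pow_zero] at hs
      rw [ht0, pow_zero] at ht
      have hc2 : c = 2 := by omega
      rw [hc2] at hpc_dvd
      have := (Nat.prime_dvd_prime_iff_eq hpp Nat.prime_two).mp hpc_dvd
      exact hp2 this
    obtain ⟨i, hi⟩ := ScaleSubmultiplicativity.exists_eq_pow_of_prime_dvd hc0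
      (fun q hq hqc => (hpc q hq hqc).resolve_right (fun h => hpc' (by rw [← h]; exact hqc)))
    -- one of `s`, `t` vanishes
    have hst : s = 0 ∨ t = 0 := by
      by_contra hst
      push Not at hst
      exact key hcop hpp (by rw [hs]; exact dvd_pow_self p hst.1) (by rw [ht]; exact dvd_pow_self p hst.2)
    left
    rcases hst with rfl | rfl
    · refine ⟨i, t, hi, ?_⟩
      rw [← hi, ← habc, hs, ht, pow_zero]
    · refine ⟨i, s, hi, ?_⟩
      rw [← hi, ← habc, hs, ht, pow_zero, add_comm]
  · -- `c` odd: `c` is a power of `p`, and `a`, `b` are powers of `2`, one of them `1`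
    have h2c : ¬ 2 ∣ c := fun h2c => (Nat.not_even_iff_odd.mpr hco) (even_iff_two_dvd.mpr h2c)
    obtain ⟨u, hu⟩ := ScaleSubmultiplicativity.exists_eq_pow_of_prime_dvd hc0
      (fun q hq hqc => (hpc q hq hqc).resolve_left (fun h => h2c (by rw [← h]; exact hqc)))
    have hu0 : u ≠ 0 := by
      rintro rfl
      rw [pow_zero] at hu
      omega
    have hpc_dvd : p ∣ c := by rw [hu]; exact dvd_pow_self p hu0
    have hpa' : ¬ p ∣ a := fun h => key hac hpp h hpc_dvd
    have hpb' : ¬ p ∣ b := fun h => key hbc hpp h hpc_dvd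
    obtain ⟨i, hi⟩ := ScaleSubmultiplicativity.exists_eq_pow_of_prime_dvd ha0
      (fun q hq hqa => (hpa q hq hqa).resolve_right (fun h => hpa' (by rw [← h]; exact hqa)))
    obtain ⟨j, hj⟩ := ScaleSubmultiplicativity.exists_eq_pow_of_prime_dvd hb0
      (fun q hq hqb => (hpb q hq hqb).resolve_right (fun h => hpb' (by rw [← h]; exact hqb)))
    have hij : i = 0 ∨ j = 0 := by
      by_contra hij
      push Not at hij
      exact key hcop Nat.prime_two (by rw [hi]; exact dvd_pow_self 2 hij.1)
        (by rw [hj]; exact dvd_pow_self 2 hij.2)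
    right
    rcases hij with rfl | rfl
    · refine ⟨j, u, hu, ?_⟩
      rw [← hu, ← habc, hi, hj, pow_zero]
    · refine ⟨i, u, hu, ?_⟩
      rw [← hu, ← habc, hi, hj, pow_zero, add_comm]

end Summit.ABC.ABC.Theorems
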